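import Literature.AnabelianGeometry.EtaleTheta.KummerContH1
import Literature.AnabelianGeometry.EtaleTheta.ContH1Discrete

/-!
# Divisibility of Kummer classes: `κ(a)|_{H'} = N · κ(a^{1/N})` on any subgroup fixing the `N`-th root

Proof-only companion (abc-iut cell, seat abc-iut-w5-d125 gen 2, layer L2; 0 definitions, no named facts)
of `KummerClass.lean` / `KummerContH1.lean` (the Kummer cocycle `h ↦ (h • x_n / x_n)_n ∈ Λ(A)` of a
compatible system of roots `x` of an `H`-invariant `a`, [cite: LANA2026Report, §6.1 p.31], and its class
in L2's continuous `H¹`, `CyclotomeCoefficients.kummerContClass`).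

THE FACT (classical Kummer theory, [cite: NeukirchSchmidtWingberg2008, I §5]; it is the cohomological form
of "`η^Θ_N … is the `N`-th root class of `Θ̈`", [EtTh] §1 p. 20, and of the DIVISIBILITY of the theta
classes in `lim_J H¹(Π_Ÿ(Π)|_J, (l·Δ_Θ)(Π))` used for [IUTchII] Prop. 2.2 (ii) "respectively" clause): for
a compatible root system `x` of `a` and `N ≥ 1`, the SHIFTED system `y_n := x_{n·N}` is a compatible root
system of the `N`-th root `x_N`, and ON THE NOSE, at the level of cocycles,

  `κ_x(h) = κ_y(h)^N`  for every `h` fixing `x_N`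

(componentwise `(h • x_{nN} / x_{nN})^N = h • x_n / x_n` by the compatibility `x_{nN}^N = x_n`). Hence on
every subgroup `H' ≤ H` fixing `x_N` the restricted Kummer class of `a` is the `N`-th power of the Kummer
class of `x_N`: Kummer classes become `N`-divisible as soon as one restricts to the stabiliser of an
`N`-th root. NO divisibility hypothesis (`RootableBy`) on the ambient group is used — only the given
root system — so the statements apply verbatim to groups of FUNCTIONS (abc-iut-L2-t12's
`ThetaKummerInput.Fn` with its `thetaRoots`), where the ambient group is not divisible.

Contents (all PROVED):
* `RootSystem.exists_shift` — the shifted root system `y` of `x_N` (`y_n = x_{n·N}`), existential form;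
* `RootSystem.mem_fixedPoints_of_root_mem` — `a` is fixed by whatever fixes `x_N`;
* `RootSystem.kummerCocycle_eq_pow_of_shift` — `κ_x(h) = κ_y(h)^N` in `Λ(A)`;
* `CyclotomeCoefficients.kummerContClass_eq_pow_of_shift` — `κ(a) = κ(x_N)^N` in `ContH1 φ A' H'` for
  `H'` fixing `x_N`; `…res_kummerContClass_eq_pow_of_shift` — the same for the restriction from `H`;
* `CyclotomeCoefficients.exists_kummerContClass_eq_pow` / `exists_res_kummerContClass_eq_pow` —
  packaged existential forms under the blanket open-stabiliser hypothesis of the [EtTh] consumers.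
Nothing here bears on [IUTchIII] Cor. 3.12; typed ≠ proved elsewhere, here everything is proved.
-/

namespace Literature.AnabelianGeometry.EtaleTheta

/-! ### The shifted root system of an `N`-th root, and the cocycle identity -/

namespace RootSystem

section Shift

variable {A : Type*} [CommGroup A] {a : A}

/-- **The shifted root system**: for a compatible root system `x` of `a` and `N ≥ 1`, `n ↦ x_{n·N}` is a
compatible root system of the `N`-th root `x_N` (existential form: no new definition is introduced).
[cite: LANA2026Report, §6.1 p.31] -/
theorem exists_shift (x : RootSystem a) (N : ℕ+) :
    ∃ y : RootSystem (x.root N), ∀ n : ℕ+, y.root n = x.root (n * N) := by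
  refine ⟨⟨fun n => x.root (n * N), ?_, fun n m => ?_⟩, fun _ => rfl⟩
  · rw [one_mul]
  · rw [mul_right_comm]
    exact x.root_mul_pow (n * N) m

variable {G : Type*} [Group G] [MulDistribMulAction G A] {H : Subgroup G}

/-- An element with an `H`-fixed `N`-th root (of a root system) is `H`-fixed (`a = x_N^N`).
[cite: LANA2026Report, §6.1 p.31] -/
theorem mem_fixedPoints_of_root_mem (x : RootSystem a) (N : ℕ+)
    (hN : x.root N ∈ MulAction.fixedPoints H A) : a ∈ MulAction.fixedPoints H A := fun h => by
  change (h : G) • a = a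
  rw [← x.pow_self N, smul_pow', show (h : G) • x.root N = x.root N from hN h]

/-- **`κ_x = κ_y^N` on the nose** for the shifted root system `y` of `x_N`, at every `h` fixing `a` and
`x_N`: componentwise `(h • x_{nN} / x_{nN})^N = h • x_n / x_n`. [cite: NeukirchSchmidtWingberg2008, I §5] -/
theorem kummerCocycle_eq_pow_of_shift (x : RootSystem a) (N : ℕ+) (y : RootSystem (x.root N))
    (hy : ∀ n : ℕ+, y.root n = x.root (n * N)) (ha : a ∈ MulAction.fixedPoints H A)
    (hN : x.root N ∈ MulAction.fixedPoints H A) (h : H) :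
    x.kummerCocycle ha h = y.kummerCocycle hN h ^ (N : ℕ) := by
  refine Subtype.ext (funext fun n => ?_)
  rw [SubmonoidClass.coe_pow, Pi.pow_apply, kummerCocycle_apply, kummerCocycle_apply, hy n, div_pow,
    ← smul_pow', x.root_mul_pow n N]

end Shift

end RootSystem

/-! ### The continuous Kummer class: `κ(a) = κ(x_N)^N` on subgroups fixing `x_N` -/

namespace CyclotomeCoefficients

variable {G G' : Type*} [Group G] [TopologicalSpace G] [SeparatelyContinuousMul G]
  [Group G'] [TopologicalSpace G'] [IsTopologicalGroup G']
  {φ : G →* G'} {A' : Subgroup G'} [A'.Normal] [IsMulCommutative A']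
  {A : Type*} [CommGroup A] [MulDistribMulAction G A] [TopologicalSpace A]
  (c : CyclotomeCoefficients φ A' A) {a : A}

omit [SeparatelyContinuousMul G] in
/-- Powers of classes are classes of powers of cocycles. [cite: NeukirchSchmidtWingberg2008, I §2] -/
theorem _root_.Literature.AnabelianGeometry.EtaleTheta.ContH1.mk_pow {H : Subgroup G} (f : H → A')
    (hf : f ∈ contCocycles φ A' H) (N : ℕ) :
    ContH1.mk f hf ^ N = ContH1.mk (f ^ N) (pow_mem hf N) := by
  induction N with
  | zero =>
    exact (pow_zero _).trans ((ContH1.mk_one (φ := φ) (A' := A') (H := H)).symm.trans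
      (ContH1.mk_congr H (pow_zero f).symm _ _))
  | succ N ih =>
    rw [pow_succ, ih, ContH1.mk_mul_mk]
    exact ContH1.mk_congr H (pow_succ f N).symm _ _

/-- **Divisibility of the continuous Kummer class.** On a subgroup `H'` fixing the `N`-th root `x_N`,
the Kummer class of `a` IS the `N`-th power of the Kummer class of `x_N` (computed with the shifted root
system `y`, `y_n = x_{nN}`): `κ(a) = κ(x_N)^N` in `ContH1 φ A' H'`. [cite: NeukirchSchmidtWingberg2008, I §5] -/
theorem kummerContClass_eq_pow_of_shift (H' : Subgroup G) (x : RootSystem a) (N : ℕ+)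
    (y : RootSystem (x.root N)) (hy : ∀ n : ℕ+, y.root n = x.root (n * N))
    (ha : a ∈ MulAction.fixedPoints H' A) (hN : x.root N ∈ MulAction.fixedPoints H' A)
    (hx : ∀ n : ℕ+, IsOpen (MulAction.stabilizer G (x.root n) : Set G))
    (hyo : ∀ n : ℕ+, IsOpen (MulAction.stabilizer G (y.root n) : Set G)) :
    c.kummerContClass H' x ha hx = c.kummerContClass H' y hN hyo ^ (N : ℕ) := by
  rw [kummerContClass, kummerContClass, ContH1.mk_pow]
  exact ContH1.mk_congr H' (funext fun h => by
    rw [Pi.pow_apply, x.kummerCocycle_eq_pow_of_shift N y hy ha hN h, map_pow]) _ _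

/-- **Restriction form.** For `H' ≤ H` with `H'` fixing `x_N`: the restriction to `H'` of the Kummer
class of `a` on `H` is the `N`-th power of the Kummer class of `x_N` on `H'` — "`κ(a)|_{H'} = N · κ(x_N)`"
(additively). [cite: NeukirchSchmidtWingberg2008, I §5] -/
theorem res_kummerContClass_eq_pow_of_shift {H H' : Subgroup G} (hle : H' ≤ H) (x : RootSystem a)
    (N : ℕ+) (y : RootSystem (x.root N)) (hy : ∀ n : ℕ+, y.root n = x.root (n * N))
    (ha : a ∈ MulAction.fixedPoints H A) (hN : x.root N ∈ MulAction.fixedPoints H' A)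
    (hx : ∀ n : ℕ+, IsOpen (MulAction.stabilizer G (x.root n) : Set G))
    (hyo : ∀ n : ℕ+, IsOpen (MulAction.stabilizer G (y.root n) : Set G)) :
    ContH1.res φ A' hle (c.kummerContClass H x ha hx) =
      c.kummerContClass H' y hN hyo ^ (N : ℕ) := by
  rw [← c.kummerContClass_eq_pow_of_shift H' x N y hy (x.mem_fixedPoints_of_root_mem N hN) hN hx hyo]
  rfl

/-! ### Packaged existential forms (blanket open stabilisers, as the [EtTh] consumers have them) -/

/-- **`κ(a)` is an `N`-th power on any subgroup fixing `x_N`** (existential packaging of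
`kummerContClass_eq_pow_of_shift`). [cite: NeukirchSchmidtWingberg2008, I §5] -/
theorem exists_kummerContClass_eq_pow (hA : ∀ b : A, IsOpen (MulAction.stabilizer G b : Set G))
    (H' : Subgroup G) (x : RootSystem a) (N : ℕ+) (ha : a ∈ MulAction.fixedPoints H' A)
    (hN : x.root N ∈ MulAction.fixedPoints H' A) :
    ∃ y : RootSystem (x.root N), (∀ n : ℕ+, y.root n = x.root (n * N)) ∧
      c.kummerContClass H' x ha (fun _ => hA _) =
        c.kummerContClass H' y hN (fun _ => hA _) ^ (N : ℕ) := by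
  obtain ⟨y, hy⟩ := x.exists_shift N
  exact ⟨y, hy, c.kummerContClass_eq_pow_of_shift H' x N y hy ha hN _ _⟩

/-- **`κ(a)|_{H'}` is an `N`-th power** for every `H' ≤ H` fixing `x_N` (existential packaging of
`res_kummerContClass_eq_pow_of_shift`). [cite: NeukirchSchmidtWingberg2008, I §5] -/
theorem exists_res_kummerContClass_eq_pow (hA : ∀ b : A, IsOpen (MulAction.stabilizer G b : Set G))
    {H H' : Subgroup G} (hle : H' ≤ H) (x : RootSystem a) (N : ℕ+)
    (ha : a ∈ MulAction.fixedPoints H A) (hN : x.root N ∈ MulAction.fixedPoints H' A) :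
    ∃ y : RootSystem (x.root N), (∀ n : ℕ+, y.root n = x.root (n * N)) ∧
      ContH1.res φ A' hle (c.kummerContClass H x ha (fun _ => hA _)) =
        c.kummerContClass H' y hN (fun _ => hA _) ^ (N : ℕ) := by
  obtain ⟨y, hy⟩ := x.exists_shift N
  exact ⟨y, hy, c.res_kummerContClass_eq_pow_of_shift hle x N y hy ha hN _ _⟩

/-- In particular the restricted class is `N`-DIVISIBLE in `ContH1 φ A' H'`.
[cite: NeukirchSchmidtWingberg2008, I §5] -/
theorem exists_pow_eq_res_kummerContClass (hA : ∀ b : A, IsOpen (MulAction.stabilizer G b : Set G))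
    {H H' : Subgroup G} (hle : H' ≤ H) (x : RootSystem a) (N : ℕ+)
    (ha : a ∈ MulAction.fixedPoints H A) (hN : x.root N ∈ MulAction.fixedPoints H' A) :
    ∃ z : ContH1 φ A' H', z ^ (N : ℕ) = ContH1.res φ A' hle (c.kummerContClass H x ha (fun _ => hA _)) := by
  obtain ⟨y, -, h⟩ := c.exists_res_kummerContClass_eq_pow hA hle x N ha hN
  exact ⟨_, h.symm⟩

end CyclotomeCoefficients

end Literature.AnabelianGeometry.EtaleTheta
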